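/-
Copyright: rh-split cell (screw, prover seat l19) gen 0, 2026-08-27.  Splitting search over kernel-typed
RH-equivalences.  A splitting `A ∧ B ⟹ RH` is CONDITIONAL bookkeeping unless `A` and `B` are both
proved; nothing here bears on the truth of RH.
-/
import Summits.RiemannHypothesis.RiemannHypothesis.Theses.ScrewPorousWall
import HarnessLib

/-!
# Route X-12 `ScrewPorousWall` — item `Assembly` PROVED (pure logic), the route decl by name

`Assembly : NoPorousPole → PorousPole → Ceil → RH`: if RH failed, the aliased pole field at step `1` would
be non-empty (`aliasedPoleSet_nonempty_of_not_rh`), `PorousPole` would give a porously accessible aliased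
pole, and `NoPorousPole` (with `Ceil = CEIL(1)`) forbids it.  Proof text = the planner's `Sketch.lean`
`closes` (rh-idea-1), four lines.

This closes the bookkeeping item only: the splitting X-12 stays CONDITIONAL on the open conjectures
`PorousPole` and `Ceil`; `NoPorousPole` is proved (`ScrewLatticePorous.noPorousPole_proof`).  RH is not
proved by this; nothing here bears on the truth of RH.  No `sorry`, no new axioms, no instances, no notation.
-/

set_option linter.dupNamespace false

namespace Summit.RiemannHypothesis.RiemannHypothesis.Theorems.Splittings.ScrewLatticePorous

open Summit.RiemannHypothesis.RiemannHypothesis.Theorems.Splittings.ScrewLatticeContinuation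

/-- **Item `Assembly` of route `ScrewPorousWall` (X-12) — PROVED** (the route decl by name; pure logic over
`aliasedPoleSet_nonempty_of_not_rh`). -/
theorem assembly_proof :
    Summit.RiemannHypothesis.RiemannHypothesis.Theses.ScrewPorousWall.Assembly := by
  intro h₁ h₂ h₃
  show RiemannHypothesis
  by_contra hRH
  obtain ⟨p, hp, κ, hκ, z, hz, hzΩ, hpor⟩ := h₂ (aliasedPoleSet_nonempty_of_not_rh one_pos hRH)
  exact h₁ 1 one_pos h₃ p hp κ hκ z hz hzΩ hpor

end Summit.RiemannHypothesis.RiemannHypothesis.Theorems.Splittings.ScrewLatticePorous
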